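import Literature.Analysis.Complex.TaylorSeriesComposition
import Literature.NumberTheory.EllipticCurves.FormalLogExpBaseChangeProofs
import Literature.NumberTheory.EllipticCurves.ModularSymbolsProofs
import Literature.NumberTheory.EllipticCurves.AnalyticRankProofs
import Literature.NumberTheory.EllipticCurves.ModularCurve
import Mathlib.Analysis.Complex.TaylorSeries
import Mathlib.Analysis.Analytic.OfScalars
import HarnessLib

/-!
# The `q`-expansion of the formal parameter along the modular parametrisation (line `nsf`, crux `StarOptBNSF`, stmt-BirchSwinnertonDyer-27047)

**Stub S2b `stub_paramExpansion` of line `nsf` v16, CLOSED** — the analytic half of the parametrisation step of route A″.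
For an elliptic `W₁/ℚ` with newform `f` (`aₙ(f) = aₙ(W₁)`), a Néron period pair `L₁` of `W₁ ⊗ ℂ` and `c₁ ∈ ℚˣ`, the local
parameter `−x/y` of the point `(℘_{L₁}(c₁u_f(τ)) − b₂/12, (℘′_{L₁}(c₁u_f(τ)) − a₁x − a₃)/2)`, `u_f(τ) = 2πi∫_{i∞}^τ f`
(tree `eichlerIntegral`), has for `Im τ` large the convergent `q`-expansion `Z(q)`, `q = e^{2πiτ}`, where
`Z := exp_{W₁}(c₁·Σₙ aₙ(W₁)qⁿ/n) ∈ ℚ⟦q⟧` is the FORMAL series whose integrality is the (closed) stub S2a; moreover `Z(0) = 0`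
and `[q¹]Z = c₁`.

Proof (pure complex analysis, every input in the tree or Mathlib): `u_f(τ) = U(q)` with `U(q) = Σₙ (aₙ/n)qⁿ` convergent on the
unit disc (`hasSum_eichlerIntegral`), so `U` has a power series at `0` and its Taylor series is `Σ (aₙ/n)qⁿ`
(`hasFPowerSeriesOnBall_of_hasSum`, Mathlib `HasFPowerSeriesOnBall.factorial_smul`); the Taylor series at `0` of the local
parameter `t = −x/y` along the uniformisation of `(W₁ ⊗ ℂ, L₁)` is `exp_{W₁ ⊗ ℂ}` (`taylor_localParam_eq_formalExp`); the Taylor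
series of the composite `t ∘ (c₁U)` is the formal composite (`Literature.Analysis.Complex.TaylorComp.taylor_comp`), which is
`Z` read in `ℂ` (`map_formalExp`, `PowerSeries.map_subst`); and an analytic function is the sum of its Taylor series on a ball
(Mathlib `Complex.hasSum_taylorSeries_on_ball`).  For `Im τ > A` the point `c₁U(q)` is a small NON-ZERO complex number
(`U` has an isolated zero at `0` since `[q¹]U = a₁ = 1`), hence not a lattice point, so `t(c₁U(q))` is literally `−x/y`.
BSD is not proved by this file; nothing here reads `r_an`.
-/

set_option linter.dupNamespace false
set_option autoImplicit false

noncomputable section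

open PowerSeries Filter
open scoped Topology Nat Classical
open Literature.NumberTheory.EllipticCurves
open Literature.NumberTheory.EllipticCurves.ModularForms
open Literature.NumberTheory.Transcendental.AndreCriterion
open Literature.Analysis.Complex.TaylorComp

/-- The Taylor series of `f : ℂ → ℂ` at `0` (local notation, as in `AndreCriterionAnalyticProofs` and
`TaylorSeriesComposition`). -/
local notation3 "𝓣[" f "]" =>
  (PowerSeries.mk fun n => ((Nat.factorial n : ℂ)⁻¹ * iteratedDeriv n f 0) : PowerSeries ℂ)

namespace Summit.BirchSwinnertonDyer.BirchSwinnertonDyer.Theorems.DepletionAtTwo.ParamExpansion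

/-! ### Scalar power series: a function given by a convergent power series near `0` has it as Taylor series -/

/-- If `U(q) = Σ bₙ qⁿ` for `‖q‖ < r` then `U` has the formal multilinear series `ofScalars b` on the ball of radius
`r/2`. [folklore] -/
theorem hasFPowerSeriesOnBall_of_hasSum {b : ℕ → ℂ} {U : ℂ → ℂ} {r : ℝ} (hr : 0 < r)
    (hU : ∀ q : ℂ, ‖q‖ < r → HasSum (fun n ↦ b n * q ^ n) (U q)) :
    HasFPowerSeriesOnBall U (FormalMultilinearSeries.ofScalars ℂ b) 0 ((r / 2).toNNReal) := by
  have hr'0 : 0 < r / 2 := by positivity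
  have hr'r : r / 2 < r := by linarith
  -- the terms `bₙ (r/2)ⁿ` are bounded
  have hs : HasSum (fun n ↦ b n * ((r / 2 : ℝ) : ℂ) ^ n) (U ((r / 2 : ℝ) : ℂ)) := hU _ (by
    rw [Complex.norm_real, Real.norm_eq_abs, abs_of_pos hr'0]; exact hr'r)
  have ht : Tendsto (fun n ↦ ‖b n * ((r / 2 : ℝ) : ℂ) ^ n‖) atTop (𝓝 0) :=
    (tendsto_zero_iff_norm_tendsto_zero).mp hs.summable.tendsto_atTop_zero
  obtain ⟨C, hC⟩ := ht.bddAbove_range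
  refine ⟨?_, by simpa using hr'0, fun {y} hy ↦ ?_⟩
  · refine FormalMultilinearSeries.le_radius_of_bound _ C fun n ↦ ?_
    rw [Real.coe_toNNReal _ hr'0.le]
    have h1 : ‖FormalMultilinearSeries.ofScalars ℂ b n‖ * (r / 2) ^ n = ‖b n * ((r / 2 : ℝ) : ℂ) ^ n‖ := by
      rw [FormalMultilinearSeries.ofScalars_norm, norm_mul, norm_pow, Complex.norm_real, Real.norm_eq_abs,
        abs_of_pos hr'0]
    rw [h1]
    exact hC ⟨n, rfl⟩
  · have hy' : ‖y‖ < r := by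
      rw [Metric.eball_coe, Metric.mem_ball, dist_zero_right, Real.coe_toNNReal _ hr'0.le] at hy
      exact hy.trans hr'r
    simp_rw [FormalMultilinearSeries.ofScalars_apply_eq, smul_eq_mul, zero_add]
    exact hU y hy'

/-- **The Taylor series at `0` of `U(q) = Σ bₙ qⁿ` (`‖q‖ < r`) is `Σ bₙ qⁿ`.** [folklore] -/
theorem taylor_eq_mk_of_hasSum {b : ℕ → ℂ} {U : ℂ → ℂ} {r : ℝ} (hr : 0 < r)
    (hU : ∀ q : ℂ, ‖q‖ < r → HasSum (fun n ↦ b n * q ^ n) (U q)) :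
    𝓣[U] = PowerSeries.mk b := by
  have h := hasFPowerSeriesOnBall_of_hasSum hr hU
  ext n
  rw [coeff_mk, coeff_mk]
  have h2 := h.factorial_smul 1 n
  rw [FormalMultilinearSeries.ofScalars_apply_eq, one_pow, smul_eq_mul, mul_one, nsmul_eq_mul,
    ← iteratedDeriv_eq_iteratedFDeriv] at h2
  rw [← h2, ← mul_assoc, inv_mul_cancel₀ (by exact_mod_cast n.factorial_ne_zero), one_mul]

/-- `U(q) = Σ bₙ qⁿ` (`‖q‖ < r`) is analytic at `0`. [folklore] -/
theorem analyticAt_of_hasSum {b : ℕ → ℂ} {U : ℂ → ℂ} {r : ℝ} (hr : 0 < r)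
    (hU : ∀ q : ℂ, ‖q‖ < r → HasSum (fun n ↦ b n * q ^ n) (U q)) : AnalyticAt ℂ U 0 :=
  (hasFPowerSeriesOnBall_of_hasSum hr hU).analyticAt

/-- `U(q) = Σ bₙ qⁿ` (`‖q‖ < r`) with `b₁ ≠ 0` does not vanish on a punctured neighbourhood of `0`. [folklore] -/
theorem eventually_ne_zero_of_hasSum {b : ℕ → ℂ} {U : ℂ → ℂ} {r : ℝ} (hr : 0 < r)
    (hU : ∀ q : ℂ, ‖q‖ < r → HasSum (fun n ↦ b n * q ^ n) (U q)) (hb : b 1 ≠ 0) :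
    ∀ᶠ q in 𝓝[≠] (0 : ℂ), U q ≠ 0 := by
  refine (hasFPowerSeriesOnBall_of_hasSum hr hU).hasFPowerSeriesAt.locally_ne_zero ?_
  intro h
  have h1 : FormalMultilinearSeries.ofScalars ℂ b 1 = 0 := by rw [h]; rfl
  exact hb ((FormalMultilinearSeries.ofScalars_eq_zero ℂ 1).mp h1)

/-- `U(0) = b₀` for `U(q) = Σ bₙ qⁿ`. [folklore] -/
theorem apply_zero_of_hasSum {b : ℕ → ℂ} {U : ℂ → ℂ} {r : ℝ} (hr : 0 < r)
    (hU : ∀ q : ℂ, ‖q‖ < r → HasSum (fun n ↦ b n * q ^ n) (U q)) : U 0 = b 0 := by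
  have h := hU 0 (by simpa using hr)
  have h2 : HasSum (fun n ↦ b n * (0 : ℂ) ^ n) (b 0 * (0 : ℂ) ^ 0) :=
    hasSum_single 0 fun n hn ↦ by simp [hn]
  rw [pow_zero, mul_one] at h2
  exact h.unique h2

/-! ### The `q`-series of the Eichler integral -/

section Eichler

variable {N : ℕ} [NeZero N] (f : CuspForm (CongruenceSubgroup.Gamma0 N) 2)

/-- **`U(q) = Σₙ (aₙ(f)/n) qⁿ` converges on the unit disc** (to its sum), because every `0 < ‖q‖ < 1` is `e^{2πiτ}` and
the series is the `q`-expansion of the Eichler integral (`hasSum_eichlerIntegral`). [cite: CremonaAlgorithms1997, §2.10] -/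
theorem hasSum_eichlerSeries (q : ℂ) (hq : ‖q‖ < 1) :
    HasSum (fun n : ℕ ↦ cuspCoeff f n / n * q ^ n) (∑' n : ℕ, cuspCoeff f n / n * q ^ n) := by
  by_cases hq0 : q = 0
  · subst hq0
    have h2 : HasSum (fun n : ℕ ↦ cuspCoeff f n / n * (0 : ℂ) ^ n) (cuspCoeff f 0 / (0 : ℕ) * (0 : ℂ) ^ 0) :=
      hasSum_single 0 fun n hn ↦ by simp [hn]
    exact h2.summable.hasSum
  · set τ₀ : ℂ := Function.Periodic.invQParam 1 q with hτ₀
    have him : 0 < τ₀.im := by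
      rw [hτ₀, Function.Periodic.im_invQParam]
      have hlog : Real.log ‖q‖ < 0 := Real.log_neg (norm_pos_iff.mpr hq0) hq
      have hneg : -(1 : ℝ) / (2 * Real.pi) < 0 := by
        rw [neg_div]; exact neg_neg_of_pos (by positivity)
      exact mul_pos_of_neg_of_neg hneg hlog
    have hqτ : Function.Periodic.qParam 1 (((⟨τ₀, him⟩ : UpperHalfPlane)) : ℂ) = q :=
      Function.Periodic.qParam_right_inv one_ne_zero hq0
    have h := hasSum_eichlerIntegral f ⟨τ₀, him⟩
    rw [hqτ] at h
    exact h.summable.hasSum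

/-- `u_f(τ) = U(e^{2πiτ})`. [cite: CremonaAlgorithms1997, §2.10] -/
theorem eichlerIntegral_eq_tsum (τ : UpperHalfPlane) :
    eichlerIntegral f τ = ∑' n : ℕ, cuspCoeff f n / n * (Function.Periodic.qParam 1 (τ : ℂ)) ^ n :=
  (hasSum_eichlerIntegral f τ).tsum_eq.symm

end Eichler

/-! ### Formal bookkeeping -/

/-- `[X¹](f ∘ g) = [X¹]f · [X¹]g` when `f(0) = g(0) = 0`. [folklore] -/
theorem coeff_one_subst_eq {K : Type*} [CommRing K] {f g : K⟦X⟧} (hf : constantCoeff f = 0)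
    (hg : constantCoeff g = 0) : coeff 1 (f.subst g) = coeff 1 f * coeff 1 g := by
  -- adapted from Cruxes/ManinPrimeToAdditiveFiveLe/Lines/neron_smooth_flog_dichotomy.lean
  rw [coeff_subst' (HasSubst.of_constantCoeff_zero' hg), finsum_eq_single _ 1]
  · rw [pow_one, smul_eq_mul]
  · intro d hd
    rcases Nat.lt_or_gt_of_ne hd with h | h
    · have hd0 : d = 0 := by omega
      subst hd0
      rw [coeff_zero_eq_constantCoeff_apply, hf, zero_smul]
    · have hX : (X : K⟦X⟧) ^ d ∣ g ^ d := pow_dvd_pow_of_dvd (X_dvd_iff.mpr hg) d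
      rw [(X_pow_dvd_iff).mp hX 1 (by omega), smul_zero]

/-- `[X¹] exp_W = 1`. [Silverman AEC IV.5.5] [folklore] -/
theorem coeff_one_formalExp {A : Type*} [CommRing A] [Algebra ℚ A] (V : WeierstrassCurve A) :
    coeff 1 V.formalExp = 1 := by
  have h := congrArg (coeff 1) V.formalLog_subst_formalExp
  rwa [coeff_one_subst_eq V.constantCoeff_formalLog V.constantCoeff_formalExp, V.coeff_one_formalLog,
    one_mul, coeff_one_X] at h

/-! ### The stub -/

/-- **STUB S2b `stub_paramExpansion` of line `nsf` v16 (crux `StarOptBNSF`, stmt-BirchSwinnertonDyer-27047) — registered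
signature verbatim.**  For `W₁/ℚ` with newform `f`, a Néron period pair `L₁` of `W₁/ℂ` and `c₁ ∈ ℚˣ`, the local parameter
`−x/y` of the point `(℘_{L₁}(c₁u_f(τ)) − b₂/12, (℘′_{L₁}(c₁u_f(τ)) − a₁x − a₃)/2)` has, for `Im τ` large, the convergent
`q`-expansion `Z(q)`, `q = e^{2πiτ}`, where `Z := exp_{W₁}(c₁·Σₙ aₙ(W₁)qⁿ/n) ∈ ℚ⟦q⟧`; moreover `Z(0) = 0` and `[q¹]Z = c₁`.
Inputs: `hasSum_eichlerIntegral` (`u_f = Σ (aₙ/n)qⁿ`), `taylor_localParam_eq_formalExp` (`𝓣[−x/y ∘ uniformisation] = exp_W`),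
`TaylorComp.taylor_comp` (Taylor series of a composite), `map_formalExp` (base change), Mathlib
`Complex.hasSum_taylorSeries_on_ball`. [cite: SilvermanAEC2009, IV.1 and VI.3.6] [cite: CremonaAlgorithms1997, §2.10] -/
theorem stub_paramExpansion :
    ∀ (W₁ : WeierstrassCurve ℚ) [W₁.IsElliptic] [W₁.IsGloballyMinimal]
      ⦃N : ℕ⦄ [NeZero N] (f : CuspForm (CongruenceSubgroup.Gamma0 N) 2), IsNewformOf W₁ f →
      ∀ (L₁ : PeriodPair), IsNeronLatticeOf (W₁.baseChange ℂ) L₁ → ∀ (c₁ : ℚ), c₁ ≠ 0 →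
      PowerSeries.constantCoeff (W₁.formalExp.subst (c₁ • (PowerSeries.mk fun j : ℕ ↦ ((W₁.LFunction j : ℤ) : ℚ) / j))) = 0 ∧
      PowerSeries.coeff 1 (W₁.formalExp.subst (c₁ • (PowerSeries.mk fun j : ℕ ↦ ((W₁.LFunction j : ℤ) : ℚ) / j))) = c₁ ∧
      ∃ A : ℝ, ∀ τ : UpperHalfPlane, A < τ.im →
        HasSum (fun n : ℕ ↦ ((PowerSeries.coeff n (W₁.formalExp.subst (c₁ • (PowerSeries.mk fun j : ℕ ↦ ((W₁.LFunction j : ℤ) : ℚ) / j))) : ℚ) : ℂ) *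
            Complex.exp (2 * Real.pi * Complex.I * (τ : ℂ)) ^ n)
          (-(L₁.weierstrassP ((c₁ : ℂ) * eichlerIntegral f τ) - ((W₁.b₂ : ℚ) : ℂ) / 12) /
            ((L₁.derivWeierstrassP ((c₁ : ℂ) * eichlerIntegral f τ)
              - ((W₁.a₁ : ℚ) : ℂ) * (L₁.weierstrassP ((c₁ : ℂ) * eichlerIntegral f τ) - ((W₁.b₂ : ℚ) : ℂ) / 12)
              - ((W₁.a₃ : ℚ) : ℂ)) / 2)) := by
  intro W₁ _ _ N _ f hf L₁ hL₁ c₁ hc₁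
  -- the rational data
  set aQ : PowerSeries ℚ := PowerSeries.mk fun j : ℕ ↦ ((W₁.LFunction j : ℤ) : ℚ) / j with haQ
  have haQ0 : constantCoeff (c₁ • aQ) = 0 := by
    rw [← coeff_zero_eq_constantCoeff_apply]; simp [haQ, coeff_mk]
  have haQ1 : coeff 1 (c₁ • aQ) = c₁ := by
    simp [haQ, coeff_mk, WeierstrassCurve.LFunction_apply_one]
  refine ⟨?_, ?_, ?_⟩
  · rw [constantCoeff_subst_of_constantCoeff_eq_zero haQ0]
    exact W₁.constantCoeff_formalExp
  · rw [coeff_one_subst_eq W₁.constantCoeff_formalExp haQ0, coeff_one_formalExp, one_mul, haQ1]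
  -- the complex data
  set W : WeierstrassCurve ℂ := W₁.baseChange ℂ with hW
  set b : ℕ → ℂ := fun n ↦ cuspCoeff f n / n with hb
  set U : ℂ → ℂ := fun q ↦ ∑' n : ℕ, cuspCoeff f n / n * q ^ n with hU
  have hUsum : ∀ q : ℂ, ‖q‖ < 1 → HasSum (fun n ↦ b n * q ^ n) (U q) := fun q hq ↦
    hasSum_eichlerSeries f q hq
  have hb1 : b 1 ≠ 0 := by
    simp [hb, hf.2 1, WeierstrassCurve.LFunction_apply_one]
  have hU0 : U 0 = 0 := by
    rw [apply_zero_of_hasSum one_pos hUsum]; simp [hb]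
  -- the inner map `X(q) = c₁ U(q)` and the local parameter `t`
  set X : ℂ → ℂ := fun q ↦ (c₁ : ℂ) * U q with hX
  set t : ℂ → ℂ := fun z ↦ if z ∈ L₁.lattice then (0 : ℂ) else
    -(L₁.weierstrassP z - W.b₂ / 12) /
      ((L₁.derivWeierstrassP z - W.a₁ * (L₁.weierstrassP z - W.b₂ / 12) - W.a₃) / 2) with ht
  have hUa : AnalyticAt ℂ U 0 := analyticAt_of_hasSum one_pos hUsum
  have hXa : AnalyticAt ℂ X 0 := analyticAt_const.mul hUa
  have hX0 : X 0 = 0 := by simp [hX, hU0]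
  have hta : AnalyticAt ℂ t 0 := (WeierstrassCurve.analyticAt_localParam L₁ W).1
  -- Taylor series: `𝓣[t ∘ X] = exp_W.subst (C c₁ * mk b) = map (Z)`
  have hTU : 𝓣[U] = PowerSeries.mk b := taylor_eq_mk_of_hasSum one_pos hUsum
  have hTX : 𝓣[X] = C (c₁ : ℂ) * PowerSeries.mk b := by
    rw [hX, taylor_const_mul, hTU]
  have hTt : 𝓣[t] = W.formalExp := WeierstrassCurve.taylor_localParam_eq_formalExp L₁ W hL₁.1 hL₁.2
  have hTcomp : 𝓣[t ∘ X] = W.formalExp.subst (C (c₁ : ℂ) * PowerSeries.mk b) := by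
    rw [taylor_comp hta hXa hX0, hTt, hTX]
  have hmapa : PowerSeries.map (algebraMap ℚ ℂ) (c₁ • aQ) = C (c₁ : ℂ) * PowerSeries.mk b := by
    ext n
    simp only [coeff_map, haQ, coeff_smul, coeff_mk, smul_eq_mul, coeff_C_mul, hb, hf.2 n, eq_ratCast]
    push_cast
    ring
  have hmapZ : PowerSeries.map (algebraMap ℚ ℂ) (W₁.formalExp.subst (c₁ • aQ)) =
      W.formalExp.subst (C (c₁ : ℂ) * PowerSeries.mk b) := by
    have hs : HasSubst (c₁ • aQ) := HasSubst.of_constantCoeff_zero' haQ0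
    have h := PowerSeries.map_subst hs (h := algebraMap ℚ ℂ) W₁.formalExp
    change PowerSeries.map (algebraMap ℚ ℂ) (W₁.formalExp.subst (c₁ • aQ)) =
      (PowerSeries.map (algebraMap ℚ ℂ) W₁.formalExp).subst (PowerSeries.map (algebraMap ℚ ℂ) (c₁ • aQ)) at h
    rw [h, WeierstrassCurve.map_formalExp, hmapa]
    rfl
  -- a ball on which `t ∘ X` is analytic and `X` avoids the lattice
  have hXtend : Tendsto X (𝓝 0) (𝓝 0) := by
    have := hXa.continuousAt.tendsto; rwa [hX0] at this
  have hE1 : ∀ᶠ q in 𝓝 (0 : ℂ), AnalyticAt ℂ (t ∘ X) q := by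
    have h1 : ∀ᶠ q in 𝓝 (0 : ℂ), AnalyticAt ℂ t (X q) := hXtend.eventually hta.eventually_analyticAt
    filter_upwards [h1, hXa.eventually_analyticAt] with q h1q h2q
    exact h1q.comp h2q
  have hE2 : ∀ᶠ q in 𝓝 (0 : ℂ), q ≠ 0 → U q ≠ 0 :=
    eventually_nhdsWithin_iff.mp (eventually_ne_zero_of_hasSum one_pos hUsum hb1)
  have hE3 : ∀ᶠ q in 𝓝 (0 : ℂ), X q ∈ (L₁.lattice \ {(0 : ℂ)} : Set ℂ)ᶜ :=
    hXtend.eventually (L₁.compl_lattice_sdiff_singleton_mem_nhds 0)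
  have hE4 : ∀ᶠ q in 𝓝 (0 : ℂ), ‖q‖ < 1 := by
    have : Metric.ball (0 : ℂ) 1 ∈ 𝓝 (0 : ℂ) := Metric.ball_mem_nhds 0 one_pos
    filter_upwards [this] with q hq
    simpa using hq
  obtain ⟨ρ, hρ0, hρ⟩ := Metric.eventually_nhds_iff_ball.mp (hE1.and (hE2.and (hE3.and hE4)))
  -- the threshold `A` with `e^{-2πA} = ρ`
  refine ⟨-Real.log ρ / (2 * Real.pi), fun τ hτ ↦ ?_⟩
  set q : ℂ := Complex.exp (2 * Real.pi * Complex.I * (τ : ℂ)) with hq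
  have hqP : Function.Periodic.qParam 1 (τ : ℂ) = q := by
    rw [hq, Function.Periodic.qParam]; simp
  have hqρ : ‖q‖ < ρ := by
    have h := (Function.Periodic.norm_qParam_lt_iff one_pos (-Real.log ρ / (2 * Real.pi)) (τ : ℂ)).mpr
      (by rwa [UpperHalfPlane.coe_im])
    rw [hqP] at h
    refine h.trans_le (le_of_eq ?_)
    have e1 : -2 * Real.pi * (-Real.log ρ / (2 * Real.pi)) = Real.log ρ := by
      field_simp
    rw [div_one, e1, Real.exp_log hρ0]
  have hqball : q ∈ Metric.ball (0 : ℂ) ρ := by simpa using hqρ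
  obtain ⟨-, hq2, hq3, hq1⟩ := hρ q hqball
  have hq0 : q ≠ 0 := Complex.exp_ne_zero _
  -- `t ∘ X` is differentiable on the ball, so it is the sum of its Taylor series there
  have hdiff : DifferentiableOn ℂ (t ∘ X) (Metric.ball 0 ρ) := fun z hz ↦
    ((hρ z hz).1.differentiableAt).differentiableWithinAt
  have hTS := Complex.hasSum_taylorSeries_on_ball hdiff hqball
  -- identify the value
  have hUq : U q = eichlerIntegral f τ := by
    rw [eichlerIntegral_eq_tsum f τ, hqP]
  have hXq : X q ∉ L₁.lattice := by
    intro hmem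
    have hne : X q ≠ 0 := mul_ne_zero (by exact_mod_cast hc₁) (hq2 hq0)
    exact hq3 ⟨hmem, hne⟩
  have hval : (t ∘ X) q = -(L₁.weierstrassP ((c₁ : ℂ) * eichlerIntegral f τ) - ((W₁.b₂ : ℚ) : ℂ) / 12) /
      ((L₁.derivWeierstrassP ((c₁ : ℂ) * eichlerIntegral f τ)
        - ((W₁.a₁ : ℚ) : ℂ) * (L₁.weierstrassP ((c₁ : ℂ) * eichlerIntegral f τ) - ((W₁.b₂ : ℚ) : ℂ) / 12)
        - ((W₁.a₃ : ℚ) : ℂ)) / 2) := by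
    rw [Function.comp_apply, ht]
    dsimp only
    rw [if_neg hXq, hX]
    dsimp only
    rw [hUq, hW]
    simp only [WeierstrassCurve.baseChange, WeierstrassCurve.map_b₂, WeierstrassCurve.map_a₁,
      WeierstrassCurve.map_a₃, eq_ratCast]
  -- identify the coefficients
  have hcoeff : ∀ n : ℕ, ((PowerSeries.coeff n (W₁.formalExp.subst (c₁ • aQ)) : ℚ) : ℂ) =
      ((Nat.factorial n : ℂ))⁻¹ * iteratedDeriv n (t ∘ X) 0 := by
    intro n
    have h := congrArg (coeff n) hTcomp
    rw [coeff_mk] at h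
    rw [h, ← hmapZ, coeff_map, eq_ratCast]
  have hfun : (fun n : ℕ ↦ ((Nat.factorial n : ℂ))⁻¹ • (q - 0) ^ n • iteratedDeriv n (t ∘ X) 0) =
      fun n : ℕ ↦ ((PowerSeries.coeff n (W₁.formalExp.subst (c₁ • aQ)) : ℚ) : ℂ) * q ^ n := by
    funext n
    rw [hcoeff n, sub_zero, smul_eq_mul, smul_eq_mul]
    ring
  rw [hval, hfun] at hTS
  exact hTS

end Summit.BirchSwinnertonDyer.BirchSwinnertonDyer.Theorems.DepletionAtTwo.ParamExpansion

end
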